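import Summits.RiemannHypothesis.RiemannHypothesis.Theorems.EarlyAppointmentsRemainder0XiKernelHighSide

/-!
# ⟨24730⟩ ρ2 v4 — LEAF 1, UPPER SIDE: the T-UNIFORM main term `∫_{T₀}^T ψ_up·log(t/2π) ≤ 2log(T₀/2π)/(T₀−x) + (2/x)log(T₀/(T₀−x))` PROVED

C4 «kernel desk» rh-idea-6 g30, director (CA406)(d).  SUPPORT module for crux r3 `Remainder0Xi` (line rho2_v4), fully proved,
standard axioms; imports = pre-image `…KernelHighSide` (C4 g30: `psiUp`).
The truncated main term of …KernelHighSide (`integral_psiUp_log_le`) carries `log T`; the `∀ᶠ T` form of LEAF 1 needs a bound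
uniform in `T`.  Here it is, by the explicit antiderivative
`Gm x t = −2·log(t/2π)/(t − x) + (2/x)·log((t − x)/t)`, `Gm' = ψ_up·log(t/2π)` (`hasDerivAt_Gm`), `Gm x T ≤ 0` for `T ≥ T₀ ≥ 2π`:
★ `integral_psiUp_log_eq (hx : 0 < x) (hxT : x < T₀) (hT : T₀ ≤ T) : ∫_{T₀}^T ψ_up·log(t/2π) = Gm x T − Gm x T₀`;
★ `integral_psiUp_log_le_uniform (hx) (hxT) (hT) (h2π : 2π ≤ T₀) :
     ∫_{T₀}^T ψ_up·log(t/2π) ≤ 2·log(T₀/2π)/(T₀ − x) + (2/x)·log(T₀/(T₀ − x))`  (uniform in `T`).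
With `T₀ = x + 66.5`, `x ≈ T_PT`: the right side is `2L′/66.5 + (2/x)·log(x/66.5 + 1) ≈ 0.0301·L′ + 2·10⁻¹¹` (`L′ = log(T₀/2π)`), i.e. the
upper main term of LEAF 1 is `≤ L′/(66.5·π) ≈ 0.00479·L′` after the `1/(2π)`.
Nothing here bears on the truth of RH; RH is not proved; 24730 OPEN.
-/

set_option linter.dupNamespace false

namespace Summit.RiemannHypothesis.RiemannHypothesis.Theorems.EarlyAppointmentsRemainder0Xi.KernelHighMain

open Set MeasureTheory intervalIntegral Real
open Summit.RiemannHypothesis.RiemannHypothesis.Theorems.EarlyAppointmentsRemainder0Xi.KernelHighSide (psiUp)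

/-- the antiderivative of `ψ_up(t)·log(t/2π)`: `Gm x t = −2·log(t/2π)/(t − x) + (2/x)·log((t − x)/t)`. -/
noncomputable def Gm (x t : ℝ) : ℝ := -(2 * Real.log (t / (2 * π)) / (t - x)) + 2 / x * Real.log ((t - x) / t)

/-- `Gm x` is an antiderivative of `psiUp x t · log(t/2π)` on `t > x > 0`. -/
theorem hasDerivAt_Gm {x t : ℝ} (hx : 0 < x) (hxt : x < t) :
    HasDerivAt (Gm x) (psiUp x t * Real.log (t / (2 * π))) t := by
  have ht0 : 0 < t := hx.trans hxt
  have htx : t - x ≠ 0 := (sub_pos.2 hxt).ne'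
  have h2pi : 0 < 2 * π := by positivity
  have hl : HasDerivAt (fun s : ℝ ↦ s / (2 * π)) (1 / (2 * π)) t := (hasDerivAt_id' t).div_const (2 * π)
  have hlog := hl.log (div_pos ht0 h2pi).ne'
  have hsub : HasDerivAt (fun s : ℝ ↦ s - x) 1 t := (hasDerivAt_id' t).sub_const x
  have hA := (hlog.const_mul 2).div hsub htx
  have hf := hsub.div (hasDerivAt_id' t) ht0.ne'
  have hB := (hf.log (div_pos (sub_pos.2 hxt) ht0).ne').const_mul (2 / x)
  have h := hA.neg.add hB
  have e1 : Gm x = fun y ↦ -(((fun y : ℝ ↦ 2 * Real.log (y / (2 * π))) / fun s : ℝ ↦ s - x) y)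
      + 2 / x * Real.log (((fun s : ℝ ↦ s - x) / fun s : ℝ ↦ s) y) := by
    funext y
    simp only [Pi.div_apply, Gm]
  rw [e1]
  refine h.congr_deriv ?_
  unfold psiUp
  simp only [Pi.div_apply]
  field_simp
  ring

/-- The high-side main integrand `psiUp x t · log(t/2π)` is continuous on `[T₀, T]` when `x < T₀` and `0 < T₀`. -/
theorem continuousOn_integrand {x T₀ T : ℝ} (hxT : x < T₀) (hT0 : 0 < T₀) :
    ContinuousOn (fun t ↦ psiUp x t * Real.log (t / (2 * π))) (Icc T₀ T) := by
  have hlt : ∀ t ∈ Icc T₀ T, x < t := fun t ht ↦ by linarith [ht.1]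
  have hcont : ContinuousOn (psiUp x) (Icc T₀ T) := by
    unfold psiUp
    refine ContinuousOn.div (by fun_prop) (by fun_prop) fun t ht ↦ ?_
    exact pow_ne_zero 2 (sub_ne_zero.2 (hlt t ht).ne')
  have hlogc : ContinuousOn (fun t : ℝ ↦ Real.log (t / (2 * π))) (Icc T₀ T) := by
    refine ContinuousOn.log (by fun_prop) fun t ht ↦ ?_
    have : 0 < t := by linarith [ht.1]
    positivity
  exact hcont.mul hlogc

/-- ★ (K) FTC: `∫_{T₀}^T ψ_up·log(t/2π) = Gm x T − Gm x T₀` for `0 < x < T₀ ≤ T`. -/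
theorem integral_psiUp_log_eq {x T₀ T : ℝ} (hx : 0 < x) (hxT : x < T₀) (hT : T₀ ≤ T) :
    ∫ t in T₀..T, psiUp x t * Real.log (t / (2 * π)) = Gm x T - Gm x T₀ := by
  have hlt : ∀ t ∈ uIcc T₀ T, x < t := by
    intro t ht
    rw [uIcc_of_le hT] at ht
    linarith [ht.1]
  have hderiv : ∀ t ∈ uIcc T₀ T, HasDerivAt (Gm x) (psiUp x t * Real.log (t / (2 * π))) t :=
    fun t ht ↦ hasDerivAt_Gm hx (hlt t ht)
  have hint : IntervalIntegrable (fun t ↦ psiUp x t * Real.log (t / (2 * π))) volume T₀ T :=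
    (continuousOn_integrand (T := T) hxT (hx.trans hxT)).intervalIntegrable_of_Icc hT
  exact integral_eq_sub_of_hasDerivAt hderiv hint

/-- (K) the antiderivative is nonpositive beyond `2π`: `Gm x T ≤ 0` for `0 < x < T`, `2π ≤ T`. -/
theorem Gm_nonpos {x T : ℝ} (hx : 0 < x) (hxT : x < T) (h2π : 2 * π ≤ T) : Gm x T ≤ 0 := by
  have h2pi : 0 < 2 * π := by positivity
  have hT0 : 0 < T := h2pi.trans_le h2π
  have hlog : 0 ≤ Real.log (T / (2 * π)) := by
    apply Real.log_nonneg
    rw [le_div_iff₀ h2pi]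
    linarith
  have h1 : 0 ≤ 2 * Real.log (T / (2 * π)) / (T - x) := div_nonneg (by positivity) (by linarith)
  have h2 : Real.log ((T - x) / T) ≤ 0 :=
    Real.log_nonpos (div_nonneg (by linarith) hT0.le) ((div_le_one hT0).2 (by linarith))
  have h3 : 0 ≤ 2 / x := by positivity
  unfold Gm
  nlinarith

/-- (K) the value at `T₀`, rewritten: `−Gm x T₀ = 2·log(T₀/2π)/(T₀ − x) + (2/x)·log(T₀/(T₀ − x))`. -/
theorem neg_Gm_eq {x T₀ : ℝ} : -Gm x T₀ = 2 * Real.log (T₀ / (2 * π)) / (T₀ - x) + 2 / x * Real.log (T₀ / (T₀ - x)) := by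
  unfold Gm
  have h : Real.log (T₀ / (T₀ - x)) = -Real.log ((T₀ - x) / T₀) := by
    rw [← Real.log_inv, inv_div]
  rw [h]
  ring

/-- ★ (K) **THE T-UNIFORM UPPER MAIN TERM of LEAF 1**: for `0 < x < T₀ ≤ T` with `2π ≤ T₀`,
`∫_{T₀}^T ψ_up·log(t/2π) ≤ 2·log(T₀/2π)/(T₀ − x) + (2/x)·log(T₀/(T₀ − x))`. -/
theorem integral_psiUp_log_le_uniform {x T₀ T : ℝ} (hx : 0 < x) (hxT : x < T₀) (hT : T₀ ≤ T) (h2π : 2 * π ≤ T₀) :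
    ∫ t in T₀..T, psiUp x t * Real.log (t / (2 * π))
      ≤ 2 * Real.log (T₀ / (2 * π)) / (T₀ - x) + 2 / x * Real.log (T₀ / (T₀ - x)) := by
  rw [integral_psiUp_log_eq hx hxT hT, ← neg_Gm_eq]
  have h := Gm_nonpos hx (hxT.trans_le hT) (h2π.trans hT)
  linarith

/-- (K) … and divided by `2π`, the form MAIN uses. -/
theorem integral_psiUp_log_div_le_uniform {x T₀ T : ℝ} (hx : 0 < x) (hxT : x < T₀) (hT : T₀ ≤ T) (h2π : 2 * π ≤ T₀) :
    (∫ t in T₀..T, psiUp x t * Real.log (t / (2 * π))) / (2 * π)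
      ≤ (2 * Real.log (T₀ / (2 * π)) / (T₀ - x) + 2 / x * Real.log (T₀ / (T₀ - x))) / (2 * π) :=
  div_le_div_of_nonneg_right (integral_psiUp_log_le_uniform hx hxT hT h2π) (by positivity)

end Summit.RiemannHypothesis.RiemannHypothesis.Theorems.EarlyAppointmentsRemainder0Xi.KernelHighMain
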